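import Literature.AlgebraicGeometry.Resolution.BlowupsRelativeCartier
import Literature.AlgebraicGeometry.Resolution.BlowupSequencesComapMarked
import Literature.AlgebraicGeometry.Resolution.SmoothStalksRegular
import Mathlib.AlgebraicGeometry.Morphisms.Smooth
import HarnessLib

/-!
# Multiple blow-ups commute with base change when the exceptional divisors are flat over the base

Topic: `Literature/AlgebraicGeometry/Resolution`. Continuation of `BlowupsRelativeCartier.lean`
(one blow-up) to the data-level multiple blow-ups `CentreSeq` of `BlowupSequences.lean` and
their induced sequences `CentreSeq.comap s ι` along an arbitrary morphism
(`BlowupSequencesExtensions.lean`, `BlowupSequencesComapMarked.lean`): the SPECIALIZATION step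
of the spreading-out arguments for the large-characteristic resolution statements
(`SpreadsShapedFromGenericPoint`, `CanonicalResolutionSpread.lean`), where a multiple blow-up
`X_r → ⋯ → X_0 = X` constructed over a base `Spec D` is restricted to the fibre
`X ×_{Spec D} Spec E` over a point (or any affine `D`-scheme) `Spec E → Spec D`, a base change
which is not flat. For a FLAT `ι` the induced sequence is the fibre product stage by stage
(`CentreSeq.isPullback_comap`, GW Prop. 13.91 (2)); here the same conclusion is PROVED for the
base change `ι : X ×_{Spec D} Spec E → X` of `Spec E → Spec D` under the hypothesis that the
exceptional divisor of every blow-up of the sequence is flat over `Spec D` (relative effective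
Cartier divisors, Stacks 056P; in the application arranged by generic flatness / smoothness
after shrinking `Spec D`):

* `blowup.isPullback_comapMap_of_flat_exceptional` — one step: the square
  `(Bl(ι), π_{X_E}, π_X, ι)` of the CHOSEN blow-ups is cartesian, `Bl_{ι^*C}(X_E) = Bl_C(X) ×_X X_E`
  (`IsBlowup.of_isPullback_of_flat_exceptional` and uniqueness of blow-ups), and
  `Bl_{ι^*C}(X_E) = Bl_C(X) ×_{Spec D} Spec E` (`blowup.isPullback_comapMap_specMap_of_flat_exceptional`).
* `CentreSeq.ExceptionalFlatOver s q` — the hypothesis, as a recursive predicate: every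
  exceptional divisor `V(C_i · 𝒪_{X_{i+1}}) ⊆ X_{i+1} = Bl_{C_i}(X_i)` is flat over `Spec D`.
* `CentreSeq.isPullback_comap_of_exceptionalFlatOver` — **the induced sequence is the fibre
  product**: `((s^*ι)_r → X_r, (s^*ι)_r → X_E, X_r → X, ι)` is cartesian;
  `CentreSeq.isPullback_comap_specMap_of_exceptionalFlatOver` — `(s^*ι)_r = X_r ×_{Spec D} Spec E`.

## Sources

* The Stacks Project, Tag 056P (relative effective Cartier divisors and base change), Tag 0805
  (blowing up and flat base change). [StacksProject]
* U. Görtz, T. Wedhorn, *Algebraic Geometry I*, 2nd ed. (2020), Def. 13.90, Prop. 13.91.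
  [GortzWedhorn2020]
* E. Bierstone, D. Grigoriev, P. Milman, J. Włodarczyk, arXiv:1206.3090, Def. 3.1.4, Thm. 8.0.5
  (induced sequences `φ^*(X_i)`). [BierstoneGrigorievMilmanWlodarczyk2011]
-/

noncomputable section

open CategoryTheory CategoryTheory.Limits AlgebraicGeometry TopologicalSpace

namespace Literature.AlgebraicGeometry.Resolution

universe u

variable {D : Type u} (E : Type u) [CommRing D] [CommRing E] [Algebra D E]

/-! ## One blow-up -/

section OneStep

variable {X XE : Scheme.{u}} (q : X ⟶ Spec (.of D)) {ι : XE ⟶ X} {sE : XE ⟶ Spec (.of E)}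

/-- **`Bl_{ι^*C}(X_E) = Bl_C(X) ×_X X_E` for the base change `ι : X_E = X ×_{Spec D} Spec E → X`,
when the exceptional divisor of `Bl_C(X)` is flat over `Spec D`**: the square formed by the
induced morphism of the chosen blow-ups `Bl(ι) : Bl_{ι^*C}(X_E) → Bl_C(X)`, the two blow-up
morphisms and `ι` is cartesian. Proof: `Bl_C(X) ×_X X_E → X_E` is a blow-up along `ι^*C`
(`IsBlowup.of_isPullback_of_flat_exceptional`), hence isomorphic to `Bl_{ι^*C}(X_E)` over `X_E`,
and the first projection corresponds to `Bl(ι)` (`blowup.hom_ext_over`).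
[cite: StacksProject, Tag 056P (1) with Tag 0805; GortzWedhorn2020, Prop. 13.91] -/
theorem blowup.isPullback_comapMap_of_flat_exceptional (C : X.IdealSheafData)
    [Flat ((C.comap (blowup.π C)).subschemeι ≫ blowup.π C ≫ q)]
    (HX : IsPullback ι sE q (specOfAlgebra D E)) :
    IsPullback (blowup.comapMap C ι) (blowup.π (C.comap ι)) (blowup.π C) ι := by
  have h1 : IsBlowup (pullback.snd (blowup.π C) ι) (C.comap ι) :=
    (blowup.isBlowup C).of_isPullback_of_flat_exceptional E q HX (IsPullback.of_hasPullback _ _)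
  obtain ⟨e, he, -⟩ := (blowup.isBlowup (C.comap ι)).unique h1
  have hfst : e.hom ≫ pullback.fst (blowup.π C) ι = blowup.comapMap C ι :=
    blowup.hom_ext_over rfl (by rw [Category.assoc, pullback.condition, reassoc_of% he])
      (blowup.comapMap_π C ι)
  exact IsPullback.of_iso_pullback ⟨blowup.comapMap_π C ι⟩ e hfst he

/-- … and `Bl_{ι^*C}(X_E) = Bl_C(X) ×_{Spec D} Spec E`: the blown-up square pasted with the
defining square of `X_E` — the blow-up of the base change is again a base change of
`Spec E → Spec D`, so that the argument iterates along a sequence of blow-ups.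
[cite: StacksProject, Tag 056P (1) with Tag 0805] -/
theorem blowup.isPullback_comapMap_specMap_of_flat_exceptional (C : X.IdealSheafData)
    [Flat ((C.comap (blowup.π C)).subschemeι ≫ blowup.π C ≫ q)]
    (HX : IsPullback ι sE q (specOfAlgebra D E)) :
    IsPullback (blowup.comapMap C ι) (blowup.π (C.comap ι) ≫ sE) (blowup.π C ≫ q)
      (specOfAlgebra D E) :=
  (blowup.isPullback_comapMap_of_flat_exceptional E q C HX).paste_vert HX

end OneStep

/-! ## Centres: the pulled-back centre is the base change of the centre -/

section Centres

variable {X XE : Scheme.{u}} (q : X ⟶ Spec (.of D)) {ι : XE ⟶ X} {sE : XE ⟶ Spec (.of E)}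

/-- **The pulled-back centre `V(ι^*C) ⊆ X_E` is the base change `V(C) ×_{Spec D} Spec E`**:
for `X_E = X ×_{Spec D} Spec E` (any cartesian square) the square
`(V(ι^*C) → V(C), V(ι^*C) → Spec E, V(C) → Spec D, Spec E → Spec D)` is cartesian (Mathlib's
`IdealSheafData.comapIso : V(ι^*C) ≅ X_E ×_X V(C)` pasted with the defining square). [folklore] -/
theorem isPullback_subschemeι_comap (C : X.IdealSheafData)
    (HX : IsPullback ι sE q (specOfAlgebra D E)) :
    IsPullback ((C.comapIso ι).hom ≫ pullback.snd ι C.subschemeι)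
      ((C.comap ι).subschemeι ≫ sE) (C.subschemeι ≫ q) (specOfAlgebra D E) := by
  have H2 : IsPullback (pullback.snd ι C.subschemeι) (pullback.fst ι C.subschemeι ≫ sE)
      (C.subschemeι ≫ q) (specOfAlgebra D E) :=
    (IsPullback.of_hasPullback ι C.subschemeι).flip.paste_vert HX
  have H3 : IsPullback (C.comapIso ι).hom
      ((C.comapIso ι).hom ≫ (pullback.fst ι C.subschemeι ≫ sE))
      (pullback.fst ι C.subschemeι ≫ sE) (𝟙 _) :=
    IsPullback.of_horiz_isIso ⟨by rw [Category.comp_id]⟩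
  have H4 : IsPullback ((C.comapIso ι).hom ≫ pullback.snd ι C.subschemeι)
      ((C.comapIso ι).hom ≫ (pullback.fst ι C.subschemeι ≫ sE)) (C.subschemeι ≫ q)
      (𝟙 _ ≫ specOfAlgebra D E) :=
    H3.paste_horiz H2
  simpa using H4

/-- **Smooth centres pull back to smooth centres**: if `V(C) → Spec D` is smooth then so is
`V(ι^*C) → Spec E` (base change). In particular, for `E = k` a field the pulled-back centre is a
regular scheme (`isRegular_subscheme_comap_of_smooth`). [folklore] -/
theorem smooth_subschemeι_comap_comp (C : X.IdealSheafData) [Smooth (C.subschemeι ≫ q)]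
    (HX : IsPullback ι sE q (specOfAlgebra D E)) : Smooth ((C.comap ι).subschemeι ≫ sE) :=
  MorphismProperty.of_isPullback (isPullback_subschemeι_comap E q C HX) ‹_›

/-- **The pulled-back centre over a field-valued point is a regular scheme** when the centre is
smooth over the base (smooth over a field ⇒ regular, Stacks 056S,
`isRegularLocalRing_stalk_of_smooth_of_field`): the admissibility condition "centres regular"
(BGMW Def. 3.1.3 (1)) for the specialized sequence. [cite: StacksProject, Tag 056S] -/
theorem isRegular_subscheme_comap_of_smooth {k : Type u} [Field k] [Algebra D k]
    {Xk : Scheme.{u}} {ι : Xk ⟶ X} {sk : Xk ⟶ Spec (.of k)} (C : X.IdealSheafData)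
    [Smooth (C.subschemeι ≫ q)] (HX : IsPullback ι sk q (specOfAlgebra D k)) :
    Scheme.IsRegular (C.comap ι).subscheme := by
  haveI := smooth_subschemeι_comap_comp k q C HX
  exact fun x => isRegularLocalRing_stalk_of_smooth_of_field ((C.comap ι).subschemeι ≫ sk) x

end Centres

/-! ## Sequences of blow-ups -/

namespace CentreSeq

/-- **All exceptional divisors of the multiple blow-up `s` of the `D`-scheme `q : X → Spec D`
are flat over `Spec D`** (recursively: the exceptional divisor `V(C_0 · 𝒪_{X_1})` of the first
chosen blow-up `X_1 = Bl_{C_0}(X) → X → Spec D` is flat over `Spec D`, and so are those of the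
remaining sequence on the `D`-scheme `X_1`). Under this hypothesis the sequence commutes with
every base change `Spec E → Spec D` (`isPullback_comap_of_exceptionalFlatOver`); it holds, after
shrinking `Spec D`, for sequences spread out from a characteristic-zero generic fibre (generic
flatness, or smoothness of the exceptional divisors of blow-ups with smooth centres).
[cite: StacksProject, Tag 056P (relative effective Cartier divisors)] -/
def ExceptionalFlatOver : {X : Scheme.{u}} → CentreSeq X → (X ⟶ Spec (.of D)) → Prop
  | _, nil _, _ => True
  | _, cons C rest, q => Flat ((C.comap (blowup.π C)).subschemeι ≫ blowup.π C ≫ q) ∧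
      ExceptionalFlatOver rest (blowup.π C ≫ q)

/-- Unfolding. [folklore] -/
@[simp] theorem exceptionalFlatOver_nil {X : Scheme.{u}} (q : X ⟶ Spec (.of D)) :
    (nil X).ExceptionalFlatOver q := trivial

/-- Unfolding. [folklore] -/
@[simp] theorem exceptionalFlatOver_cons {X : Scheme.{u}} (C : X.IdealSheafData)
    (rest : CentreSeq (blowup C)) (q : X ⟶ Spec (.of D)) :
    (cons C rest).ExceptionalFlatOver q ↔
      Flat ((C.comap (blowup.π C)).subschemeι ≫ blowup.π C ≫ q) ∧
        rest.ExceptionalFlatOver (blowup.π C ≫ q) :=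
  Iff.rfl

/-- **A multiple blow-up with exceptional divisors flat over `Spec D` commutes with the base
change `Spec E → Spec D`**: for `ι : X_E → X` with `X_E = X ×_{Spec D} Spec E` (any cartesian
square), the induced sequence `s^*ι` (`CentreSeq.comap`: centres pulled back, blow-ups the
chosen ones) is the fibre product stage by stage — the square
`((s^*ι)_r → X_r, (s^*ι)_r → X_E, X_r → X, ι)` is cartesian (one step:
`blowup.isPullback_comapMap_of_flat_exceptional`; the blown-up square is again a base change of
`Spec E → Spec D`, and `IsPullback.paste_vert`).
[cite: StacksProject, Tag 056P (1) with Tag 0805; BierstoneGrigorievMilmanWlodarczyk2011, Thm. 8.0.5 (induced sequence)] -/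
theorem isPullback_comap_of_exceptionalFlatOver :
    ∀ {X XE : Scheme.{u}} (s : CentreSeq X) (q : X ⟶ Spec (.of D)) (_ : s.ExceptionalFlatOver q)
      {ι : XE ⟶ X} {sE : XE ⟶ Spec (.of E)} (_ : IsPullback ι sE q (specOfAlgebra D E)),
      IsPullback (s.comapι ι) (s.comap ι).comp s.comp ι
  | X, XE, nil _, _, _, ι, _, _ =>
    show IsPullback ι (𝟙 XE) (𝟙 X) ι from IsPullback.of_vert_isIso ⟨by simp⟩
  | _, _, cons C rest, q, hs, ι, _, HX => by
    haveI := hs.1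
    have H1 := blowup.isPullback_comapMap_of_flat_exceptional E q C HX
    show IsPullback (comapι rest (blowup.comapMap C ι))
      ((rest.comap (blowup.comapMap C ι)).comp ≫ blowup.π (C.comap ι)) (rest.comp ≫ blowup.π C) ι
    exact (isPullback_comap_of_exceptionalFlatOver rest (blowup.π C ≫ q) hs.2
      (H1.paste_vert HX)).paste_vert H1

/-- … and `(s^*ι)_r = X_r ×_{Spec D} Spec E`: the top of the induced sequence is the base change
of the top of `s`. [cite: StacksProject, Tag 056P (1) with Tag 0805] -/
theorem isPullback_comap_specMap_of_exceptionalFlatOver {X XE : Scheme.{u}} (s : CentreSeq X)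
    (q : X ⟶ Spec (.of D)) (hs : s.ExceptionalFlatOver q) {ι : XE ⟶ X} {sE : XE ⟶ Spec (.of E)}
    (HX : IsPullback ι sE q (specOfAlgebra D E)) :
    IsPullback (s.comapι ι) ((s.comap ι).comp ≫ sE) (s.comp ≫ q) (specOfAlgebra D E) :=
  (isPullback_comap_of_exceptionalFlatOver E s q hs HX).paste_vert HX

/-- In particular every blow-up of the induced sequence is a base change of the corresponding
blow-up of `s`: for `s = (C_0, rest)`, the tail of `s^*ι` is the induced sequence of `rest`
along `Bl(ι)`, which is again a base change of `Spec E → Spec D` with exceptional divisors flat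
over `Spec D` (the recursion behind `isPullback_comap_of_exceptionalFlatOver`, exposed).
[cite: StacksProject, Tag 056P (1) with Tag 0805] -/
theorem ExceptionalFlatOver.tail {X XE : Scheme.{u}} {C : X.IdealSheafData}
    {rest : CentreSeq (blowup C)} {q : X ⟶ Spec (.of D)} (hs : (cons C rest).ExceptionalFlatOver q)
    {ι : XE ⟶ X} {sE : XE ⟶ Spec (.of E)} (HX : IsPullback ι sE q (specOfAlgebra D E)) :
    rest.ExceptionalFlatOver (blowup.π C ≫ q) ∧
      IsPullback (blowup.comapMap C ι) (blowup.π (C.comap ι) ≫ sE) (blowup.π C ≫ q)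
        (specOfAlgebra D E) := by
  haveI := hs.1
  exact ⟨hs.2, blowup.isPullback_comapMap_specMap_of_flat_exceptional E q C HX⟩

end CentreSeq

end Literature.AlgebraicGeometry.Resolution

end
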